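import Summits.Ventures.CertifiedManyBodySolver.Rows.DopedTLCorrAffine
import Summits.Ventures.CertifiedManyBodySolver.Rows.DopedTLCorrBoxWindow
import Literature.MathematicalPhysics.QuantumLattice.HubbardEnergyDensityChordBounds
import Mathlib.Data.Fin.VecNotation
import HarnessLib

/-!
# Thermodynamic-limit correlator rows of the `t–t'` square lattice ACROSS THE DENSITY: what ONE window
# certificate proves at EVERY filling, the density leg of the fast layer, and the BOX ROW it yields on a
# filling segment `{U} × {t'} × [n₁, n₂]` (cell `pub/hubbard-downfold`, MO-S1 ↔ S2 seam, D-0096 / D-0150 L-DF2)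

HONEST FRAMING: first certified bounds on pairing observables / stiffness CEILINGS; not a superconductivity
verdict. NOTHING IS ASSERTED HERE: every bound-valued statement is a `def … : Prop` or takes row predicates as
hypotheses; no `sorry`, no named fact, zero compute. Seat hubbard-downfold-unc-2 (robustness lemmas in the FILLING
direction, `prover-hubbard-downfold-unc-2-g12-0`); companion of `Rows/DopedTLCorrAffine.lean` (hubbard-obs p2: the
fast layer in the ENERGY WINDOW at ONE density) and `Rows/DopedTLCorrBoxWindow.lean` (hubbard-algo box-eng-3: box rows
over cells of `θ = (U, t', n)`).

WHY. A downfolded material arrives with a FILLING INTERVAL — the La₂CuO₄ parent box of record `boxLa214E_M13v110`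
carries `n ∈ [0.99, 1.01]` (`Downfold/BoxesLa214V110.lean`) — while the venture's claim nodes state
`SquareTTPrimeCorrOrbitLowerRow tp U n u r S Λ X` at ONE density: as typed, nothing transports in `n`. But a window
certificate is density-blind except for its filling rows: the tree's soundness theorem
`InfVolFermionState.IsTorusLimitOf.re_sum_expect_d4_ge_of_window_certificate_TT'_ineq_of_window`
(`Literature/…/HubbardNNNHoppingTorusLimitCorrelatorWindow`; box form `…_of_fillingBox`) reads ONE identity —
objective `Xw`, constant `c`, residual `Σₖ‖aₖ‖`, energy rows `lo ≤ e ≤ hi`, filling rows `Σ_σ μ_σ (n_{0σ} − ν)` — at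
ANY density `x ∈ [0, 2)`: for every torus-limit ground state `ω` of density `x` with `lo ≤ e₀(t', U, x) ≤ hi`,
`c − Σₖ‖aₖ‖ + (Σ_σ μ_σ)(x/2 − ν) ≤ |S|⁻¹ Σ_{γ∈S} Re ω_{γΛ}(Γ(d4Emb γ 0) X)` — AFFINE in `x`, slope `s = (Σ_σ μ_σ)/2`.
So a certificate solved at the anchor density `n₀` is, at zero solver cost, a row at every density whose energy
lies in its window, value `r + s·(x − n₀)`, once the producer prints ONE more field, `2s = Σ_σ μ_σ` (today's
nodes print `q, hi, lo, κhi, κlo`). This file types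

* §A the DENSITY-PARAMETRISED ROW PREDICATES `SquareTTPrimeCorrOrbitLowerRowWN tp U lo hi r s n₀ S Λ X` (two FIXED
  energy rows, value `r + s(x − n₀)` at every density `x ∈ [0, 2)` whose energy lies in `[lo, hi]` — the
  conclusion shape of the soundness theorem, binder list of `Rows/DopedTLCorrWindow.lean` §A with the density
  universally quantified; translation-only certificates are the case `S = {1}`), and the AFFINE form
  `SquareTTPrimeCorrAffineOrbitLowerRowN tp U q hi lo κhi κlo s n₀ S Λ X` (no energy hypothesis; value
  `q + s(x − n₀) + κhi(hi − e₀(x)) + κlo(e₀(x) − lo)` = (★) of `Rows/DopedTLCorrAffine.lean` with the density slope);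
* §B the solver-free EDGES: affine-N ⇒ window-N on every window (`….rowWN`, re-pricing by `reprice`); the POINT rows
  of `Rows/DopedTLCorr*.lean` at any density of `[0, 2)` (`….orbitRowW_at`, `….orbitLowerRow_at`,
  `….affineOrbitLowerRow_at`; at `x = n₀` today's node shapes);
* §C the BOX ROW ON A FILLING SEGMENT: on the degenerate cell `Set.Icc ![U, t', n₁] ![U, t', n₂]` a window-N row IS
  hubbard-algo's box window row `SquareTTPrimeCorrOrbitLowerBoxRowW … flo cap r' S Λ X` for every functional window
  `[flo, cap] ⊆ [lo, hi]` and every slot `r'` below the two endpoint values (`….orbitLowerBoxRowW_segment`); the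
  CHORD-CAP form of the affine-N row (`….orbitLowerBoxRowW_segment_chord`: caps `u₁, u₂` at the ends, cap function
  = density chord, discharged by convexity of `e₀` in `n` — `energyDensityTT'_le_density_chord`, Ruelle 1969 §3.3 —
  value again affine in the density, slot = smaller endpoint value); and back: a segment box row with its window
  discharged is the point row at EVERY density of the segment (`….orbitLowerRow_of_segment`). Re-priced POINT
  certificates and `boxdual/0` BOX words thus meet in ONE predicate, the one the segment leaves of
  `Observables/StiffnessFillingSegmentLeaf.lean` consume.

WHAT THIS IS NOT: a claim that any existing node carries a density slope (none does today); a transport in `U` or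
`t'` (stationarity rows are Hamiltonian-specific — `Rows/DopedTLCorrAffine.lean` §C; the kinetic `U`-ray is Griffiths
monotonicity, `Observables/StiffnessTLKineticCeilingURay.lean`); a number.

References: J. Wang et al., PRX 14 (2024) 031006, §III eq. (obsopt) [WangEtAl2024]; S. Boyd, L. Vandenberghe,
*Convex Optimization* (2004), §5.6 [BoydVandenberghe2004]; D. Ruelle, *Statistical Mechanics: Rigorous Results*
(1969), §3.3 [Ruelle1969].
-/
noncomputable section

namespace Summit.Ventures.CertifiedManyBodySolver

open Literature.MathematicalPhysics.QuantumLattice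
open Matrix HubbardWave0 Literature.Probability.LatticeModels ThermodynamicLimit Filter Topology
open scoped ComplexOrder BigOperators

/-! ## §A  Density-parametrised correlator row predicates (`t = 1`, NNN hopping `tp`, coupling `U`) -/

section Defs

/-- §A (WINDOW-N, `D₄`-ORBIT-MEAN form). Square lattice `ℤ²`, `t = 1`, NNN hopping `tp`, coupling `U`; two FIXED
energy rows `lo, hi`, value `r` at the anchor density `n₀`, density slope `s`: for EVERY density `x ∈ [0, 2)`, every
torus limit `ω` of unit ground states `ψ` of the sectors `(rectN x L_j, S^z = 0)` of `hubbardTorusTT' L_j 1 tp U`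
along `L_j → ∞`, GIVEN `lo ≤ e₀(tp, U, x) ≤ hi`,
`r + s·(x − n₀) ≤ |S|⁻¹ Σ_{γ ∈ S} Re ω_{γΛ}(Γ(d4Emb γ 0) X)` — the conclusion of the tree's window-certificate soundness
theorem read at density `x` (`r = c − Σ‖a‖ + (Σ_σ μ_σ)(n₀/2 − ν)`, `s = (Σ_σ μ_σ)/2`). [cite: WangEtAl2024, §III] -/
def SquareTTPrimeCorrOrbitLowerRowWN (tp U : ℝ) (lo hi r s n₀ : ℚ) (S : Finset (DihedralGroup 4))
    (Λ : Finset (Site 2)) (X : FermionOp Λ) : Prop :=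
  ∀ x : ℝ, 0 ≤ x → x < 2 →
    ∀ (ω : InfVolFermionState 2) (Ls : ℕ → ℕ) (ψ : ∀ L, Fock (Orb (FermionTorus 2 L))),
      Tendsto Ls atTop atTop →
      (∀ j, IsGroundStateInSector (hubbardTorusTT' (Ls j) 1 tp U) (rectN x (Ls j)) 0 (ψ (Ls j))) →
      (∀ j, star (ψ (Ls j)) ⬝ᵥ ψ (Ls j) = 1) → ω.IsTorusLimitOf ψ Ls →
      ((lo : ℚ) : ℝ) ≤ energyDensityTT' 1 tp U x → energyDensityTT' 1 tp U x ≤ ((hi : ℚ) : ℝ) →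
      ((r : ℚ) : ℝ) + ((s : ℚ) : ℝ) * (x - ((n₀ : ℚ) : ℝ)) ≤
        (S.card : ℝ)⁻¹ * ∑ g ∈ S, (ω.expect (d4ShiftSet g 0 Λ) (fermionEmbed (PolySite.d4Emb g 0 Λ) X)).re

/-- §A (AFFINE-N, `D₄`-ORBIT-MEAN form). Same density-parametrised class, NO energy hypothesis, conclusion
`q + s·(x − n₀) + κhi·(hi − e₀(tp,U,x)) + κlo·(e₀(tp,U,x) − lo) ≤ |S|⁻¹ Σ_{γ ∈ S} Re ω_{γΛ}(Γ(d4Emb γ 0) X)`: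
the weak-duality inequality (★) of `Rows/DopedTLCorrAffine.lean` with the density slope `s = (Σ_σ μ_σ)/2` kept —
the full Lagrangian content of a two-energy-row window certificate solved at density `n₀`. [cite: BoydVandenberghe2004, §5.6] -/
def SquareTTPrimeCorrAffineOrbitLowerRowN (tp U : ℝ) (q hi lo κhi κlo s n₀ : ℚ)
    (S : Finset (DihedralGroup 4)) (Λ : Finset (Site 2)) (X : FermionOp Λ) : Prop :=
  ∀ x : ℝ, 0 ≤ x → x < 2 →
    ∀ (ω : InfVolFermionState 2) (Ls : ℕ → ℕ) (ψ : ∀ L, Fock (Orb (FermionTorus 2 L))),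
      Tendsto Ls atTop atTop →
      (∀ j, IsGroundStateInSector (hubbardTorusTT' (Ls j) 1 tp U) (rectN x (Ls j)) 0 (ψ (Ls j))) →
      (∀ j, star (ψ (Ls j)) ⬝ᵥ ψ (Ls j) = 1) → ω.IsTorusLimitOf ψ Ls →
      ((q : ℚ) : ℝ) + ((s : ℚ) : ℝ) * (x - ((n₀ : ℚ) : ℝ)) +
          ((κhi : ℚ) : ℝ) * (((hi : ℚ) : ℝ) - energyDensityTT' 1 tp U x) +
          ((κlo : ℚ) : ℝ) * (energyDensityTT' 1 tp U x - ((lo : ℚ) : ℝ)) ≤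
        (S.card : ℝ)⁻¹ * ∑ g ∈ S, (ω.expect (d4ShiftSet g 0 Λ) (fermionEmbed (PolySite.d4Emb g 0 Λ) X)).re

end Defs

/-! ## §B  Solver-free edges: re-pricing, point rows at any density -/

section Edges

variable {tp U : ℝ} {lo hi r s n₀ q κhi κlo hi' lo' r' : ℚ} {S : Finset (DihedralGroup 4)}
  {Λ : Finset (Site 2)} {X : FermionOp Λ}

/-- Slot monotonicity: a window-N row survives any SMALLER value `r' ≤ r` (same slope). -/
theorem SquareTTPrimeCorrOrbitLowerRowWN.mono (h : SquareTTPrimeCorrOrbitLowerRowWN tp U lo hi r s n₀ S Λ X)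
    (hr : r' ≤ r) : SquareTTPrimeCorrOrbitLowerRowWN tp U lo hi r' s n₀ S Λ X := by
  intro x hx0 hx2 ω Ls ψ hLs hψ hψ1 hω hl hu
  have hh := h x hx0 hx2 ω Ls ψ hLs hψ hψ1 hω hl hu
  have hr' : ((r' : ℚ) : ℝ) ≤ ((r : ℚ) : ℝ) := by exact_mod_cast hr
  linarith

/-- Window monotonicity: a window-N row survives any TIGHTER window `[lo', hi'] ⊆ [lo, hi]`. -/
theorem SquareTTPrimeCorrOrbitLowerRowWN.mono_window
    (h : SquareTTPrimeCorrOrbitLowerRowWN tp U lo hi r s n₀ S Λ X) (hlo : lo ≤ lo') (hhi : hi' ≤ hi) :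
    SquareTTPrimeCorrOrbitLowerRowWN tp U lo' hi' r s n₀ S Λ X := by
  intro x hx0 hx2 ω Ls ψ hLs hψ hψ1 hω hl hu
  have hlo' : ((lo : ℚ) : ℝ) ≤ ((lo' : ℚ) : ℝ) := by exact_mod_cast hlo
  have hhi' : ((hi' : ℚ) : ℝ) ≤ ((hi : ℚ) : ℝ) := by exact_mod_cast hhi
  exact h x hx0 hx2 ω Ls ψ hLs hψ hψ1 hω (hlo'.trans hl) (hu.trans hhi')

/-- The pointwise arithmetic behind the density re-pricing: at the unknown `e₀ ∈ [lo', hi']`,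
`reprice q hi lo κhi κlo hi' lo' + s(x − n₀) ≤ q + s(x − n₀) + κhi(hi − e₀) + κlo(e₀ − lo)`. -/
theorem reprice_add_slope_le_affine {e₀ x : ℝ} (hκhi : 0 ≤ κhi) (hκlo : 0 ≤ κlo)
    (hlo' : ((lo' : ℚ) : ℝ) ≤ e₀) (hhi' : e₀ ≤ ((hi' : ℚ) : ℝ)) :
    ((reprice q hi lo κhi κlo hi' lo' : ℚ) : ℝ) + ((s : ℚ) : ℝ) * (x - ((n₀ : ℚ) : ℝ)) ≤
      ((q : ℚ) : ℝ) + ((s : ℚ) : ℝ) * (x - ((n₀ : ℚ) : ℝ)) + ((κhi : ℚ) : ℝ) * (((hi : ℚ) : ℝ) - e₀) +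
        ((κlo : ℚ) : ℝ) * (e₀ - ((lo : ℚ) : ℝ)) := by
  have h := reprice_le_affine (q := q) (hi := hi) (lo := lo) hκhi hκlo hlo' hhi'
  linarith

/-- **THE DENSITY FAST LAYER.** An affine-N orbit row with `κhi, κlo ≥ 0` is the window-N orbit row on EVERY
window `[lo', hi']`, with the re-priced anchor value `reprice q hi lo κhi κlo hi' lo' = q + κhi(hi − hi') + κlo(lo' − lo)`
and the SAME density slope `s`: one certificate, every window, every density. [cite: BoydVandenberghe2004, §5.6] -/
theorem SquareTTPrimeCorrAffineOrbitLowerRowN.rowWN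
    (h : SquareTTPrimeCorrAffineOrbitLowerRowN tp U q hi lo κhi κlo s n₀ S Λ X) (hκhi : 0 ≤ κhi)
    (hκlo : 0 ≤ κlo) :
    SquareTTPrimeCorrOrbitLowerRowWN tp U lo' hi' (reprice q hi lo κhi κlo hi' lo') s n₀ S Λ X :=
  fun x hx0 hx2 ω Ls ψ hLs hψ hψ1 hω hl hu =>
    (reprice_add_slope_le_affine hκhi hκlo hl hu).trans (h x hx0 hx2 ω Ls ψ hLs hψ hψ1 hω)

/-- At the certificate's OWN window: value `q`, slope `s`. -/
theorem SquareTTPrimeCorrAffineOrbitLowerRowN.rowWN_self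
    (h : SquareTTPrimeCorrAffineOrbitLowerRowN tp U q hi lo κhi κlo s n₀ S Λ X) (hκhi : 0 ≤ κhi)
    (hκlo : 0 ≤ κlo) : SquareTTPrimeCorrOrbitLowerRowWN tp U lo hi q s n₀ S Λ X := by
  simpa using h.rowWN (hi' := hi) (lo' := lo) hκhi hκlo

/-- **Affine-N ⇒ the POINT affine row at any rational density `x ∈ [0, 2)`** (`Rows/DopedTLCorrAffine.lean` §A), with
value `q + s(x − n₀)`; at `x = n₀` this is the anchor's affine row of record. [cite: BoydVandenberghe2004, §5.6] -/
theorem SquareTTPrimeCorrAffineOrbitLowerRowN.affineOrbitLowerRow_at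
    (h : SquareTTPrimeCorrAffineOrbitLowerRowN tp U q hi lo κhi κlo s n₀ S Λ X) {x : ℚ} (hx0 : 0 ≤ x)
    (hx2 : x < 2) :
    SquareTTPrimeCorrAffineOrbitLowerRow tp U x (q + s * (x - n₀)) hi lo κhi κlo S Λ X := by
  intro ω Ls ψ hLs hψ hψ1 hω
  have hh := h (x : ℝ) (by exact_mod_cast hx0) (by exact_mod_cast hx2) ω Ls ψ hLs hψ hψ1 hω
  push_cast at hh ⊢
  linarith

/-- **Window-N ⇒ the two-row POINT predicate at any real density `x ∈ [0, 2)`** (`Rows/DopedTLCorrWindow.lean` §A) for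
every rational slot `r' ≤ r + s(x − n₀)`. [cite: WangEtAl2024, §III] -/
theorem SquareTTPrimeCorrOrbitLowerRowWN.orbitRowW_at
    (h : SquareTTPrimeCorrOrbitLowerRowWN tp U lo hi r s n₀ S Λ X) {x : ℝ} (hx0 : 0 ≤ x) (hx2 : x < 2)
    (hr' : ((r' : ℚ) : ℝ) ≤ ((r : ℚ) : ℝ) + ((s : ℚ) : ℝ) * (x - ((n₀ : ℚ) : ℝ))) :
    SquareTTPrimeCorrOrbitLowerRowW tp U x lo hi r' S Λ X :=
  fun ω Ls ψ hLs hψ hψ1 hω hl hu => hr'.trans (h x hx0 hx2 ω Ls ψ hLs hψ hψ1 hω hl hu)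

/-- **Window-N ⇒ the one-row POINT predicate at any real density `x ∈ [0, 2)`** (`Rows/DopedTLCorr.lean` §B: floor as a
premise, cap `hi` by value) for every rational slot `r' ≤ r + s(x − n₀)` — the shape the anchor-generic leaf
dischargers of `Observables/RungLeavesStiffnessAnchor.lean` consume. [cite: WangEtAl2024, §III] -/
theorem SquareTTPrimeCorrOrbitLowerRowWN.orbitLowerRow_at
    (h : SquareTTPrimeCorrOrbitLowerRowWN tp U lo hi r s n₀ S Λ X) {x : ℝ} (hx0 : 0 ≤ x) (hx2 : x < 2)
    (hl : ((lo : ℚ) : ℝ) ≤ energyDensityTT' 1 tp U x)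
    (hr' : ((r' : ℚ) : ℝ) ≤ ((r : ℚ) : ℝ) + ((s : ℚ) : ℝ) * (x - ((n₀ : ℚ) : ℝ))) :
    SquareTTPrimeCorrOrbitLowerRow tp U x hi r' S Λ X :=
  fun ω Ls ψ hLs hψ hψ1 hω hu => hr'.trans (h x hx0 hx2 ω Ls ψ hLs hψ hψ1 hω hl hu)

/-- An affine function of the density on `[n₁, n₂]` is at least the smaller endpoint value. [folklore] -/
theorem min_endpoints_le_affine_density {C s a n₁ n₂ x : ℝ} (h₁ : n₁ ≤ x) (h₂ : x ≤ n₂) :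
    min (C + s * (n₁ - a)) (C + s * (n₂ - a)) ≤ C + s * (x - a) := by
  rcases le_total 0 s with hs | hs
  · exact (min_le_left _ _).trans (by nlinarith)
  · exact (min_le_right _ _).trans (by nlinarith)

end Edges

/-! ## §C  The box row on a filling SEGMENT `{U} × {t'} × [n₁, n₂]` (box coordinates `θ = (U, t', n)`) -/

section Segment

variable {tp U : ℝ} {lo hi r s n₀ q κhi κlo r' : ℚ} {S : Finset (DihedralGroup 4)}
  {Λ : Finset (Site 2)} {X : FermionOp Λ}

/-- Membership in the degenerate cell `Set.Icc ![U, tp, n₁] ![U, tp, n₂]`: the first two coordinates are pinned,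
the density ranges over `[n₁, n₂]`. [folklore] -/
theorem mem_fillingSegment_iff {U tp n₁ n₂ : ℝ} {θ : Fin 3 → ℝ} :
    θ ∈ Set.Icc ![U, tp, n₁] ![U, tp, n₂] ↔ θ 0 = U ∧ θ 1 = tp ∧ n₁ ≤ θ 2 ∧ θ 2 ≤ n₂ := by
  rw [Set.mem_Icc, Pi.le_def, Pi.le_def, Fin.forall_fin_succ, Fin.forall_fin_succ, Fin.forall_fin_one,
    Fin.forall_fin_succ, Fin.forall_fin_succ, Fin.forall_fin_one]
  simp only [Matrix.cons_val_zero, Fin.succ_zero_eq_one, Fin.succ_one_eq_two]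
  constructor
  · rintro ⟨⟨h0, h1, h2⟩, ⟨h0', h1', h2'⟩⟩
    exact ⟨le_antisymm h0' h0, le_antisymm h1' h1, h2, h2'⟩
  · rintro ⟨h0, h1, h2, h2'⟩
    exact ⟨⟨h0.ge, h1.ge, h2⟩, ⟨h0.le, h1.le, h2'⟩⟩

/-- Conversely every density of `[n₁, n₂]` is the density coordinate of the point `![U, tp, x]` of the cell. -/
theorem vec3_mem_fillingSegment {U tp n₁ n₂ x : ℝ} (hx : x ∈ Set.Icc n₁ n₂) :
    ![U, tp, x] ∈ Set.Icc ![U, tp, n₁] ![U, tp, n₂] :=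
  mem_fillingSegment_iff.2 ⟨by simp, by simp, by simpa using hx.1, by simpa using hx.2⟩

/-- **Window-N row ⇒ BOX WINDOW ROW on a filling segment.** `0 ≤ n₁`, `n₂ < 2`; a functional window `[flo θ, cap θ]`
INSIDE the certificate's window on the cell (`lo ≤ flo θ`, `cap θ ≤ hi`) and a slot `r'` below both endpoint values
`r + s(nᵢ − n₀)`: then `SquareTTPrimeCorrOrbitLowerBoxRowW ![U,tp,n₁] ![U,tp,n₂] flo cap r' S Λ X`
(`Rows/DopedTLCorrBoxWindow.lean` §A — the predicate of hubbard-algo's `boxdual/0` words). [cite: WangEtAl2024, §III] -/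
theorem SquareTTPrimeCorrOrbitLowerRowWN.orbitLowerBoxRowW_segment
    (h : SquareTTPrimeCorrOrbitLowerRowWN tp U lo hi r s n₀ S Λ X) {n₁ n₂ : ℝ} (hn₁ : 0 ≤ n₁) (hn₂ : n₂ < 2)
    {flo cap : (Fin 3 → ℝ) → ℝ}
    (hflo : ∀ θ ∈ Set.Icc ![U, tp, n₁] ![U, tp, n₂], ((lo : ℚ) : ℝ) ≤ flo θ)
    (hcap : ∀ θ ∈ Set.Icc ![U, tp, n₁] ![U, tp, n₂], cap θ ≤ ((hi : ℚ) : ℝ))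
    (hr₁ : ((r' : ℚ) : ℝ) ≤ ((r : ℚ) : ℝ) + ((s : ℚ) : ℝ) * (n₁ - ((n₀ : ℚ) : ℝ)))
    (hr₂ : ((r' : ℚ) : ℝ) ≤ ((r : ℚ) : ℝ) + ((s : ℚ) : ℝ) * (n₂ - ((n₀ : ℚ) : ℝ))) :
    SquareTTPrimeCorrOrbitLowerBoxRowW ![U, tp, n₁] ![U, tp, n₂] flo cap r' S Λ X := by
  intro θ hθ ω Ls ψ hLs hψ hψ1 hω hl hu
  obtain ⟨h0, h1, hx1, hx2⟩ := mem_fillingSegment_iff.1 hθ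
  rw [h0, h1] at hψ hl hu
  have hmin := min_endpoints_le_affine_density (C := ((r : ℚ) : ℝ)) (s := ((s : ℚ) : ℝ))
    (a := ((n₀ : ℚ) : ℝ)) hx1 hx2
  have hr'' : ((r' : ℚ) : ℝ) ≤ ((r : ℚ) : ℝ) + ((s : ℚ) : ℝ) * (θ 2 - ((n₀ : ℚ) : ℝ)) :=
    (le_min hr₁ hr₂).trans hmin
  exact hr''.trans (h (θ 2) (hn₁.trans hx1) (lt_of_le_of_lt hx2 hn₂) ω Ls ψ hLs hψ hψ1 hω
    ((hflo θ hθ).trans hl) (hu.trans (hcap θ hθ)))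

/-- The density CHORD of two caps `u₁` (at `n₁`) and `u₂` (at `n₂`), as a cap function on the box coordinates. -/
def chordCap (n₁ n₂ u₁ u₂ : ℝ) (θ : Fin 3 → ℝ) : ℝ :=
  ((n₂ - θ 2) * u₁ + (θ 2 - n₁) * u₂) / (n₂ - n₁)

/-- At the left end the chord is the left cap. -/
theorem chordCap_left {n₁ n₂ u₁ u₂ : ℝ} (h : n₁ < n₂) {θ : Fin 3 → ℝ} (hθ : θ 2 = n₁) :
    chordCap n₁ n₂ u₁ u₂ θ = u₁ := by
  have hd : n₂ - n₁ ≠ 0 := sub_ne_zero.2 (ne_of_gt h)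
  rw [chordCap, hθ, div_eq_iff hd]
  ring

/-- At the right end the chord is the right cap. -/
theorem chordCap_right {n₁ n₂ u₁ u₂ : ℝ} (h : n₁ < n₂) {θ : Fin 3 → ℝ} (hθ : θ 2 = n₂) :
    chordCap n₁ n₂ u₁ u₂ θ = u₂ := by
  have hd : n₂ - n₁ ≠ 0 := sub_ne_zero.2 (ne_of_gt h)
  rw [chordCap, hθ, div_eq_iff hd]
  ring

/-- **The chord cap is DISCHARGED on the segment by convexity in the density** (`energyDensityTT'_le_density_chord`,
Ruelle 1969 §3.3): `U ≥ 0`, `0 ≤ n₁ < n₂ < 2`, certified caps `e₀(tp,U,n₁) ≤ u₁`, `e₀(tp,U,n₂) ≤ u₂` ⇒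
`e₀(tp, U, θ 2) ≤ chordCap n₁ n₂ u₁ u₂ θ` at every point of the cell. [cite: Ruelle1969, §3.3] -/
theorem energyDensityTT'_le_chordCap_of_mem_fillingSegment (hU : 0 ≤ U) {n₁ n₂ u₁ u₂ : ℝ} (hn₁ : 0 ≤ n₁)
    (h12 : n₁ < n₂) (hn₂ : n₂ < 2) (hu₁ : energyDensityTT' 1 tp U n₁ ≤ u₁)
    (hu₂ : energyDensityTT' 1 tp U n₂ ≤ u₂) :
    ∀ θ ∈ Set.Icc ![U, tp, n₁] ![U, tp, n₂],
      energyDensityTT' 1 (θ 1) (θ 0) (θ 2) ≤ chordCap n₁ n₂ u₁ u₂ θ := by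
  intro θ hθ
  obtain ⟨h0, h1, hx1, hx2⟩ := mem_fillingSegment_iff.1 hθ
  rw [h0, h1]
  rcases eq_or_lt_of_le hx1 with hx1 | hx1
  · rw [chordCap_left h12 hx1.symm, ← hx1]; exact hu₁
  rcases eq_or_lt_of_le hx2 with hx2 | hx2
  · rw [chordCap_right h12 hx2, hx2]; exact hu₂
  exact energyDensityTT'_le_density_chord 1 tp hU hn₁ hx1 hx2 hn₂ hu₁ hu₂

/-- The re-priced value along the chord is affine in the density: at `θ 2 = x`,
`q + s(x − n₀) + κhi(hi − chord(x)) + κlo(lo' − lo)` is at least the smaller of its two endpoint values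
`vᵢ = q + s(nᵢ − n₀) + κhi(hi − uᵢ) + κlo(lo' − lo)`. [folklore] -/
theorem min_endpoints_le_reprice_chord {qr sr n0 khi klo hir lor lo'r n₁ n₂ u₁ u₂ x : ℝ} (h12 : n₁ < n₂)
    (hx1 : n₁ ≤ x) (hx2 : x ≤ n₂) :
    min (qr + sr * (n₁ - n0) + khi * (hir - u₁) + klo * (lo'r - lor))
        (qr + sr * (n₂ - n0) + khi * (hir - u₂) + klo * (lo'r - lor)) ≤
      qr + sr * (x - n0) + khi * (hir - ((n₂ - x) * u₁ + (x - n₁) * u₂) / (n₂ - n₁)) + klo * (lo'r - lor) := by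
  have hd : 0 < n₂ - n₁ := sub_pos.2 h12
  set a : ℝ := (n₂ - x) / (n₂ - n₁) with ha
  set b : ℝ := (x - n₁) / (n₂ - n₁) with hb
  have ha0 : 0 ≤ a := div_nonneg (sub_nonneg.2 hx2) hd.le
  have hb0 : 0 ≤ b := div_nonneg (sub_nonneg.2 hx1) hd.le
  have hab : a + b = 1 := by rw [ha, hb, ← add_div, div_eq_one_iff_eq hd.ne']; ring
  -- the target value is the convex combination `a·v₁ + b·v₂` of the endpoint values
  have hx : x = a * n₁ + b * n₂ := by rw [ha, hb]; field_simp; ring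
  have hch : ((n₂ - x) * u₁ + (x - n₁) * u₂) / (n₂ - n₁) = a * u₁ + b * u₂ := by rw [ha, hb]; field_simp
  rw [hch]
  set v₁ := qr + sr * (n₁ - n0) + khi * (hir - u₁) + klo * (lo'r - lor) with hv₁
  set v₂ := qr + sr * (n₂ - n0) + khi * (hir - u₂) + klo * (lo'r - lor) with hv₂
  have hconv : qr + sr * (x - n0) + khi * (hir - (a * u₁ + b * u₂)) + klo * (lo'r - lor) = a * v₁ + b * v₂ := by
    rw [hv₁, hv₂, hx]
    linear_combination (-(qr - sr * n0 + khi * hir + klo * (lo'r - lor))) * hab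
  rw [hconv]
  rcases le_total v₁ v₂ with hv | hv
  · calc min v₁ v₂ = v₁ := min_eq_left hv
      _ = (a + b) * v₁ := by rw [hab, one_mul]
      _ ≤ a * v₁ + b * v₂ := by nlinarith [mul_le_mul_of_nonneg_left hv hb0]
  · calc min v₁ v₂ = v₂ := min_eq_right hv
      _ = (a + b) * v₂ := by rw [hab, one_mul]
      _ ≤ a * v₁ + b * v₂ := by nlinarith [mul_le_mul_of_nonneg_left hv ha0]

/-- **Affine-N row ⇒ BOX WINDOW ROW on a filling segment with the CHORD CAP.** `U ≥ 0`, `0 ≤ n₁ < n₂ < 2`,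
`κhi, κlo ≥ 0`; caps `u₁, u₂` (the chord's end values — their validity `e₀ ≤ uᵢ` is NOT needed for the row, only for its
discharge `energyDensityTT'_le_chordCap_of_mem_fillingSegment`); a constant floor slot `lo'`; and a slot `r'` below both
endpoint values `q + s(nᵢ − n₀) + κhi(hi − uᵢ) + κlo(lo' − lo)`. Then
`SquareTTPrimeCorrOrbitLowerBoxRowW ![U,tp,n₁] ![U,tp,n₂] (fun _ => lo') (chordCap n₁ n₂ u₁ u₂) r' S Λ X`.
[cite: BoydVandenberghe2004, §5.6] -/
theorem SquareTTPrimeCorrAffineOrbitLowerRowN.orbitLowerBoxRowW_segment_chord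
    (h : SquareTTPrimeCorrAffineOrbitLowerRowN tp U q hi lo κhi κlo s n₀ S Λ X) (hκhi : 0 ≤ κhi)
    (hκlo : 0 ≤ κlo) {n₁ n₂ u₁ u₂ lo' : ℚ} (hn₁ : 0 ≤ n₁) (h12 : n₁ < n₂) (hn₂ : n₂ < 2)
    (hr₁ : r' ≤ q + s * (n₁ - n₀) + κhi * (hi - u₁) + κlo * (lo' - lo))
    (hr₂ : r' ≤ q + s * (n₂ - n₀) + κhi * (hi - u₂) + κlo * (lo' - lo)) :
    SquareTTPrimeCorrOrbitLowerBoxRowW ![U, tp, ((n₁ : ℚ) : ℝ)] ![U, tp, ((n₂ : ℚ) : ℝ)]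
      (fun _ => ((lo' : ℚ) : ℝ)) (chordCap ((n₁ : ℚ) : ℝ) ((n₂ : ℚ) : ℝ) ((u₁ : ℚ) : ℝ) ((u₂ : ℚ) : ℝ))
      r' S Λ X := by
  intro θ hθ ω Ls ψ hLs hψ hψ1 hω hl hu
  obtain ⟨h0, h1, hx1, hx2⟩ := mem_fillingSegment_iff.1 hθ
  rw [h0, h1] at hψ hl hu
  have h12r : ((n₁ : ℚ) : ℝ) < ((n₂ : ℚ) : ℝ) := by exact_mod_cast h12
  have hx0 : 0 ≤ θ 2 := le_trans (by exact_mod_cast hn₁) hx1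
  have hx2' : θ 2 < 2 := lt_of_le_of_lt hx2 (by exact_mod_cast hn₂)
  have hrow := h (θ 2) hx0 hx2' ω Ls ψ hLs hψ hψ1 hω
  -- affine bound (★) at the unknown energy, then the chord cap and the floor
  have hκhi' : (0 : ℝ) ≤ ((κhi : ℚ) : ℝ) := by exact_mod_cast hκhi
  have hκlo' : (0 : ℝ) ≤ ((κlo : ℚ) : ℝ) := by exact_mod_cast hκlo
  have hcapx : ((κhi : ℚ) : ℝ) * (((hi : ℚ) : ℝ) - chordCap ((n₁ : ℚ) : ℝ) ((n₂ : ℚ) : ℝ) ((u₁ : ℚ) : ℝ)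
      ((u₂ : ℚ) : ℝ) θ) ≤ ((κhi : ℚ) : ℝ) * (((hi : ℚ) : ℝ) - energyDensityTT' 1 tp U (θ 2)) :=
    mul_le_mul_of_nonneg_left (by linarith) hκhi'
  have hflox : ((κlo : ℚ) : ℝ) * (((lo' : ℚ) : ℝ) - ((lo : ℚ) : ℝ)) ≤
      ((κlo : ℚ) : ℝ) * (energyDensityTT' 1 tp U (θ 2) - ((lo : ℚ) : ℝ)) :=
    mul_le_mul_of_nonneg_left (by linarith) hκlo'
  have hmin := min_endpoints_le_reprice_chord (qr := ((q : ℚ) : ℝ)) (sr := ((s : ℚ) : ℝ))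
    (n0 := ((n₀ : ℚ) : ℝ)) (khi := ((κhi : ℚ) : ℝ)) (klo := ((κlo : ℚ) : ℝ)) (hir := ((hi : ℚ) : ℝ))
    (lor := ((lo : ℚ) : ℝ)) (lo'r := ((lo' : ℚ) : ℝ)) (u₁ := ((u₁ : ℚ) : ℝ)) (u₂ := ((u₂ : ℚ) : ℝ))
    h12r hx1 hx2
  have hr₁' : ((r' : ℚ) : ℝ) ≤ ((q : ℚ) : ℝ) + ((s : ℚ) : ℝ) * (((n₁ : ℚ) : ℝ) - ((n₀ : ℚ) : ℝ)) +
      ((κhi : ℚ) : ℝ) * (((hi : ℚ) : ℝ) - ((u₁ : ℚ) : ℝ)) + ((κlo : ℚ) : ℝ) * (((lo' : ℚ) : ℝ) - ((lo : ℚ) : ℝ)) := by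
    exact_mod_cast hr₁
  have hr₂' : ((r' : ℚ) : ℝ) ≤ ((q : ℚ) : ℝ) + ((s : ℚ) : ℝ) * (((n₂ : ℚ) : ℝ) - ((n₀ : ℚ) : ℝ)) +
      ((κhi : ℚ) : ℝ) * (((hi : ℚ) : ℝ) - ((u₂ : ℚ) : ℝ)) + ((κlo : ℚ) : ℝ) * (((lo' : ℚ) : ℝ) - ((lo : ℚ) : ℝ)) := by
    exact_mod_cast hr₂
  simp only [chordCap] at hcapx
  linarith [le_min hr₁' hr₂', hmin, hcapx, hflox, hrow]

/-- **UNCONDITIONAL SHAPE on the segment** (the cap discharged by the chord, the floor by a certified device valid on the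
segment — a constant lower row, a density tangent, a particle–hole line): for every density `x ∈ [n₁, n₂]` and every
torus-limit ground state at `(tp, U, x)`, `r' ≤ |S|⁻¹ Σ Re ω(…)`. Literally `SquareTTPrimeCorrOrbitLowerBoxRow….uncond`
read through `vec3_mem_fillingSegment`. [cite: WangEtAl2024, §III] -/
theorem SquareTTPrimeCorrOrbitLowerBoxRowW.forall_density_of_segment {n₁ n₂ : ℝ} {flo cap : (Fin 3 → ℝ) → ℝ}
    (h : SquareTTPrimeCorrOrbitLowerBoxRowW ![U, tp, n₁] ![U, tp, n₂] flo cap r' S Λ X)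
    (hflo : ∀ θ ∈ Set.Icc ![U, tp, n₁] ![U, tp, n₂], flo θ ≤ energyDensityTT' 1 (θ 1) (θ 0) (θ 2))
    (hcap : ∀ θ ∈ Set.Icc ![U, tp, n₁] ![U, tp, n₂], energyDensityTT' 1 (θ 1) (θ 0) (θ 2) ≤ cap θ) :
    ∀ x ∈ Set.Icc n₁ n₂, ∀ (ω : InfVolFermionState 2) (Ls : ℕ → ℕ) (ψ : ∀ L, Fock (Orb (FermionTorus 2 L))),
      Tendsto Ls atTop atTop →
      (∀ j, IsGroundStateInSector (hubbardTorusTT' (Ls j) 1 tp U) (rectN x (Ls j)) 0 (ψ (Ls j))) →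
      (∀ j, star (ψ (Ls j)) ⬝ᵥ ψ (Ls j) = 1) → ω.IsTorusLimitOf ψ Ls →
      ((r' : ℚ) : ℝ) ≤ (S.card : ℝ)⁻¹ *
        ∑ g ∈ S, (ω.expect (d4ShiftSet g 0 Λ) (fermionEmbed (PolySite.d4Emb g 0 Λ) X)).re := by
  intro x hx ω Ls ψ hLs hψ hψ1 hω
  have hθ := vec3_mem_fillingSegment (U := U) (tp := tp) hx
  have hh := h _ hθ ω Ls ψ hLs
  simp only [Matrix.cons_val_zero, Matrix.cons_val_one, Matrix.head_cons, Matrix.cons_val_two,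
    Matrix.tail_cons] at hh
  have hf := hflo _ hθ
  have hc := hcap _ hθ
  simp only [Matrix.cons_val_zero, Matrix.cons_val_one, Matrix.head_cons, Matrix.cons_val_two,
    Matrix.tail_cons] at hf hc
  exact hh hψ hψ1 hω hf hc

/-- **Point rows at every density of the segment** from a box window row whose window is discharged there: for every
`x ∈ [n₁, n₂]` and EVERY rational cap slot `u`, `SquareTTPrimeCorrOrbitLowerRow tp U x u r' S Λ X` (the energy
hypothesis of the point row is no longer needed — the window has been discharged on the whole segment). This is the
shape consumed by `ObsStiffnessSeqCeilingAt_of_oddMomentTT_orbitLowerRow[_univ]`. [cite: WangEtAl2024, §III] -/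
theorem SquareTTPrimeCorrOrbitLowerBoxRowW.orbitLowerRow_of_segment {n₁ n₂ : ℝ} {flo cap : (Fin 3 → ℝ) → ℝ}
    (h : SquareTTPrimeCorrOrbitLowerBoxRowW ![U, tp, n₁] ![U, tp, n₂] flo cap r' S Λ X)
    (hflo : ∀ θ ∈ Set.Icc ![U, tp, n₁] ![U, tp, n₂], flo θ ≤ energyDensityTT' 1 (θ 1) (θ 0) (θ 2))
    (hcap : ∀ θ ∈ Set.Icc ![U, tp, n₁] ![U, tp, n₂], energyDensityTT' 1 (θ 1) (θ 0) (θ 2) ≤ cap θ)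
    {x : ℝ} (hx : x ∈ Set.Icc n₁ n₂) (u : ℚ) :
    SquareTTPrimeCorrOrbitLowerRow tp U x u r' S Λ X :=
  fun ω Ls ψ hLs hψ hψ1 hω _ => h.forall_density_of_segment hflo hcap x hx ω Ls ψ hLs hψ hψ1 hω

end Segment

end Summit.Ventures.CertifiedManyBodySolver

end
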